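import Summits.AnomalousDissipation.AnomalousDissipation.Theses.LimitingAbsorption

/-!
# Sketch — crux-ideate stmt-AnomalousDissipation-2940 (`RelaxationBoundsInventory`), ideator 1, round 1

First lemmas of the two idea cards (signatures only; `sorry` bodies):

* Card `spacetime-adjoint-duality` — `forcedPairing_reversed`, `releasePairing_ae`,
  `cesaro_inventory_le` (the Cesàro-level target reached by the line).
* Card `phase-continuous-duhamel` — `birthModulus` (uniform strong continuity at birth),
  `restart_ae`, `phaseContinuity`.
-/

noncomputable section

open MeasureTheory Set Filter
open scoped InnerProductSpace

namespace Summit.AnomalousDissipation.AnomalousDissipation.Cruxes.RelaxationBoundsInventory.Sketch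

open Literature.Analysis Literature.Analysis.FluidPDE Literature.Analysis.FluidPDE.Torus

local notation "𝕋²" => UnitAddTorus (Fin 2)
local notation "E²" => EuclideanSpace ℝ (Fin 2)

/-! ## Card A: space–time adjoint duality -/

/-- **A1 (first lemma). Forward/backward pairing in the weak class, zero data at both ends.**
`θ`: sourced forward weak solution (drift `u`, source `s₁`, datum `0` at `t = 0`);
`χ`: sourced weak solution of the REVERSED problem (drift `-u(T-·)`, source `s₂(T-·)`, datum `0`),
so that `Ψ(t) = χ(T-t)` solves the adjoint equation `∂ₜΨ + u·∇Ψ + κΔΨ = -s₂`, `Ψ(T) = 0`.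
Then `∫₀ᵀ⟨s₁(t), Ψ(t)⟩ dt = ∫₀ᵀ⟨θ(t), s₂(t)⟩ dt` — no trace of either solution is needed. -/
theorem forcedPairing_reversed {T κ : ℝ} (hκ : 0 < κ) (hT : 0 < T)
    {u : ℝ → 𝕋² → E²}
    (hu : MemLp (FunctionSpaces.Torus.stLift u) ⊤ (volume.restrict (Ioo 0 T ×ˢ univ)))
    {s₁ s₂ θ χ : ℝ → 𝕋² → ℝ}
    (hs₁ : MemLp (FunctionSpaces.Torus.stLift s₁) 2 (volume.restrict (Ioo 0 T ×ˢ univ)))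
    (hs₂ : MemLp (FunctionSpaces.Torus.stLift s₂) 2 (volume.restrict (Ioo 0 T ×ˢ univ)))
    (hθ : IsWeakScalarTransportForcedOn T κ u s₁ 0 θ)
    (hχ : IsWeakScalarTransportForcedOn T κ (fun σ x => -u (T - σ) x) (fun σ => s₂ (T - σ)) 0 χ) :
    ∫ t in Ioo 0 T, ∫ x, s₁ t x * χ (T - t) x = ∫ t in Ioo 0 T, ∫ x, θ t x * s₂ t x := by
  sorry

/-- **A2. Release pairing at a.e. birth phase.** With `χ` as above (adjoint with source `s₂`,
zero final datum) and ANY release `Θ` of the profile `h` at phase `t₀` (homogeneous weak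
solution with drift `u(t₀+·)`, datum `h`): `⟨h, Ψ(t₀)⟩ = ∫_{t₀}^T ⟨Θ(σ-t₀), s₂(σ)⟩ dσ` for a.e.
`t₀` (the only trace, `Ψ(t₀) = χ(T-t₀)`, is of the scalar function `t ↦ ⟨h, χ(T-t)⟩`, which is
a.e. equal to a continuous function). The null set depends on `χ`, `h` only. -/
theorem releasePairing_ae {T κ : ℝ} (hκ : 0 < κ) (hT : 0 < T)
    {u : ℝ → 𝕋² → E²}
    (hu : MemLp (FunctionSpaces.Torus.stLift u) ⊤ (volume.restrict (Ioo 0 T ×ˢ univ)))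
    {h : 𝕋² → ℝ} (hh : MemLp h 2 volume)
    {s₂ χ : ℝ → 𝕋² → ℝ}
    (hs₂ : MemLp (FunctionSpaces.Torus.stLift s₂) 2 (volume.restrict (Ioo 0 T ×ˢ univ)))
    (hχ : IsWeakScalarTransportForcedOn T κ (fun σ x => -u (T - σ) x) (fun σ => s₂ (T - σ)) 0 χ) :
    ∀ᵐ t₀ ∂(volume.restrict (Ioo 0 T)), ∀ Θ : ℝ → 𝕋² → ℝ,
      IsWeakScalarTransportOn (T - t₀) κ (fun τ => u (t₀ + τ)) h Θ →
        ∫ x, h x * χ (T - t₀) x = ∫ σ in Ioo t₀ T, ∫ x, Θ (σ - t₀) x * s₂ σ x := by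
  sorry

/-- **A3 (what the line reaches). Cesàro inventory bound at every finite horizon**, under the
hypotheses of the crux: `∫₀ᵀ ‖θ(t)‖² dt ≤ T · 4C/γ² · ‖h‖²` for every `T > 0`; `timeMean ≤ 4C/γ²‖h‖²`
and the `longTimeAvgSup` bound of `RelaxationBoundsInventory` follow at once. -/
theorem cesaro_inventory_le (κ : ℝ) (u : ℝ → 𝕋² → E²) (h : 𝕋² → ℝ) (C γ : ℝ)
    (hκ : 0 < κ) (hC : 0 ≤ C) (hγ : 0 < γ) (hh : MemLp h 2 volume)
    (hu : ∀ T : ℝ, 0 < T →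
      MemLp (FunctionSpaces.Torus.stLift u) ⊤ (volume.restrict (Ioo 0 T ×ˢ univ)))
    (hU : ∀ s : ℝ, 0 ≤ s → ∀ (T : ℝ) (Θ : ℝ → 𝕋² → ℝ),
      IsWeakScalarTransportOn T κ (fun t => u (s + t)) h Θ →
        ∀ᵐ t ∂(volume.restrict (Ioo 0 T)),
          scalarL2Sq (Θ t) ≤ C * Real.exp (-(γ * t)) * scalarL2Sq h)
    (θ : ℝ → 𝕋² → ℝ) (hθ : IsWeakScalarTransportForced κ u (fun _ => h) 0 θ)
    {T : ℝ} (hT : 0 < T) :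
    ∫ t in Ioo 0 T, scalarL2Sq (θ t) ≤ T * (4 * C / γ ^ 2 * scalarL2Sq h) := by
  sorry

/-! ## Card B: phase-continuous Duhamel -/

/-- **B1 (first lemma). Uniform strong continuity at birth.** A release `Θ` of `h ∈ L²` into a
drift bounded by `M` on the slab obeys, for every smooth comparison profile `g` with
`‖∇g‖, |Δg| ≤ K` and a.e. `τ ∈ (0,T)`,
`‖Θ(τ) - h‖² ≤ 4‖h‖‖h - g‖ + 2τK(M + κ)‖h‖`:
energy inequality `‖Θ(τ)‖ ≤ ‖h‖` (`lintegral_sq_add_le_holds`) + the steady-test identity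
`⟨Θ(τ), g⟩ = ⟨h, g⟩ + ∫₀^τ⟨Θ, u·∇g + κΔg⟩` (`IsWeakScalarTransportOn.ae_integral_mul_eq`).
The modulus is independent of the phase (only `M`, `κ`, `h` enter). -/
theorem birthModulus {T κ M K : ℝ} (hκ : 0 < κ)
    {u : ℝ → 𝕋² → E²}
    (hu : MemLp (FunctionSpaces.Torus.stLift u) ⊤ (volume.restrict (Ioo 0 T ×ˢ univ)))
    (huM : ∀ᵐ t ∂(volume.restrict (Ioo 0 T)), ∀ᵐ x ∂(volume : Measure 𝕋²), ‖u t x‖ ≤ M)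
    {h g : 𝕋² → ℝ} (hh : MemLp h 2 volume) (hg : FunctionSpaces.Torus.IsSmooth g)
    (hK : ∀ x, ‖FunctionSpaces.Torus.gradient g x‖ ≤ K ∧ |FunctionSpaces.Torus.laplacian g x| ≤ K)
    {Θ : ℝ → 𝕋² → ℝ} (hΘ : IsWeakScalarTransportOn T κ u h Θ) :
    ∀ᵐ τ ∂(volume.restrict (Ioo 0 T)),
      scalarL2Sq (fun x => Θ τ x - h x) ≤
        4 * Real.sqrt (scalarL2Sq h) * Real.sqrt (scalarL2Sq (fun x => h x - g x)) +
          2 * τ * K * (M + κ) * Real.sqrt (scalarL2Sq h) := by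
  sorry

/-- **B2. Restart at a.e. later time.** A weak solution with bounded drift restarts, at a.e.
`a ∈ (0,T)`, as a weak solution on `[0, T-a)` with the shifted drift and datum `Θ(a) ∈ L²`. -/
theorem restart_ae {T κ : ℝ} (hκ : 0 < κ)
    {u : ℝ → 𝕋² → E²}
    (hu : MemLp (FunctionSpaces.Torus.stLift u) ⊤ (volume.restrict (Ioo 0 T ×ˢ univ)))
    {h : 𝕋² → ℝ} (hh : MemLp h 2 volume)
    {Θ : ℝ → 𝕋² → ℝ} (hΘ : IsWeakScalarTransportOn T κ u h Θ) :
    ∀ᵐ a ∂(volume.restrict (Ioo 0 T)),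
      MemLp (Θ a) 2 volume ∧
        IsWeakScalarTransportOn (T - a) κ (fun τ => u (a + τ)) (Θ a) (fun τ => Θ (a + τ)) := by
  sorry

/-- **B3. Phase continuity of the release map** (from B1 + B2 + the `L²` contraction
`ae_scalarL2Sq_le`): releases `Θ s` of `h` at nearby phases `s ≤ s'` are uniformly close in
`L²((s', T) × T²)` after placement in absolute time. Consequence: the Riemann–Duhamel
superpositions `W_N` already in the tree are CAUCHY in `L²((0,T) × T²)`. -/
theorem phaseContinuity {T κ : ℝ} (hκ : 0 < κ) (hT : 0 < T)
    {u : ℝ → 𝕋² → E²}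
    (hu : MemLp (FunctionSpaces.Torus.stLift u) ⊤ (volume.restrict (Ioo 0 T ×ˢ univ)))
    {h : 𝕋² → ℝ} (hh : MemLp h 2 volume)
    {Θ : ℝ → ℝ → 𝕋² → ℝ}
    (hΘ : ∀ s, 0 ≤ s → s < T → IsWeakScalarTransportOn (T - s) κ (fun τ => u (s + τ)) h (Θ s)) :
    ∀ ε : ℝ, 0 < ε → ∃ δ : ℝ, 0 < δ ∧ ∀ s s' : ℝ, 0 ≤ s → s ≤ s' → s' ≤ s + δ → s' < T →
      ∫ t in Ioo s' T, scalarL2Sq (fun x => Θ s (t - s) x - Θ s' (t - s') x) ≤ ε := by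
  sorry

end Summit.AnomalousDissipation.AnomalousDissipation.Cruxes.RelaxationBoundsInventory.Sketch

end
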